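import Literature.NumberTheory.Automorphic.HeckeAlgebra
import HarnessLib

/-!
# Gelfand's trick: commutativity of Hecke operators from an anti-involution

Trunk `AutomorphicAxiomatic` (G19), topic `NumberTheory/Automorphic`; generic complement to
`HeckeAlgebra` (the concrete Hecke operators `heckeOperator ρ K g = ∑_{yK ⊆ KgK} ρ(y)` on the
`K`-fixed vectors of a representation `ρ` of a group `G`). Third layer (S3) of the branch
turning the named fact `Flath1979_heckeOperatorAt_ofLocal_eq_smul` of `UnramifiedHeckeScalars`
into a theorem (decomposition of `Literature.NumberTheory.Automorphic.exists_cuspidal_baseChange_of_not_dvd`,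
**lang.S23**, Arthur–Clozel (1989), Ch. 3, Thm. 4.2 (a)); see `CartanDecompositionGLn` (S2)
and `HilbertRepSchur` (S1).

**Gelfand's trick** (Bump, *Automorphic Forms and Representations* (1997), Thm. 4.6.1 and the
proof of Thm. 3.3.3; Getz–Hahn (2024), Thm. 5.5.1; Deitmar–Echterhoff (2014), Thm. 11.2.4 (a)):
if `t` is an anti-involution of `G` preserving `K` and fixing every double coset `K g K`
(`t g ∈ K g K`), the Hecke algebra of `(G, K)` is commutative. It is proved here directly for
the operators `[KxK]`, `[KyK]` on `V^K`, for an arbitrary representation `ρ` of `G` over a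
commutative ring and without Haar measure, in the following relative form suited to restricted
products: `K ≤ M ≤ G`, `t(K) ⊆ K`, `t g ∈ K g K` for `g ∈ M` only, and `x, y ∈ M` with finite
`KxK/K`, `KyK/K` (`heckeOperator_comm_apply_of_antiInvolution`). For `M = GL_n(F) ↪ G`,
`K = GL_n(𝒪)` and `t` = transpose, the double-coset hypothesis is the Cartan decomposition
(`CartanDecompositionGLn.exists_glTranspose_eq_mul_mul`).

## The argument (all proved)

* `heckeOperator_heckeOperator_apply` (**product formula**): for `v ∈ V^K`,
  `[KxK]([KyK] v) = ∑ᶠ_{γ ∈ G/K} N_{x,y}(γ) • ρ(γ) v` with the **pair count**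
  `heckePairCount K x y γ = #{α ∈ KxK/K | α⁻¹ γ ∈ KyK/K}` (the structure constants of
  `𝟙_{KxK} * 𝟙_{KyK}`; Bump (1997), §4.6) — regroup the double sum along `β ↦ α β`.
* `heckePairCount_smul`: `N_{x,y}` is left `K`-invariant; `heckePairCount_eq_zero_of_out_not_mem`:
  it vanishes off the cosets meeting `M`.
* `heckePairCount_le_unop_map` (**Gelfand's injection**): `a K ↦ t(a⁻¹ c) K` injects
  `{aK ⊆ KxK | a⁻¹c ∈ KyK}` into `{bK ⊆ KyK | b⁻¹ t(c) ∈ KxK}`, so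
  `N_{x,y}(cK) ≤ N_{y,x}(t(c)K)`; with `t ∘ t = id` and `t c ∈ K c K` this gives
  `heckePairCount_comm`: `N_{x,y}(cK) = N_{y,x}(cK)`.
* `heckeOperator_comm_apply_of_antiInvolution`: the two product formulas agree term by term.

Also recorded, for the sequel (irreducibility of `V^K` and adjoints of Hecke operators on
unitary representations, Deitmar–Echterhoff (2014), proof of Thm. 11.2.4 (b)):
`heckeOperator_mul_mul_eq` (`[K k₁gk₂ K] = [KgK]`), `heckeOperator_apply_comm_of_commute`
(Hecke operators of finite double cosets commute with `ρ(c)` for `c` centralising `K` and `x`),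
`map_heckeOperator_eq_card_smul` (**averaging formula** `P([KxK] v) = #(KxK/K) • P(ρ(x) v)` for
any `K`-invariant additive map `P`, e.g. the orthogonal projection onto `V^K`), and
`ncard_orbit_inv_eq` (`#(Kx⁻¹K/K) = #(KxK/K)` under the anti-involution — the degree equality
behind `[KxK]* = [Kx⁻¹K]`).

## Design notes

* The anti-automorphism is a `MulEquiv` `τ : G ≃* Gᵐᵒᵖ` (`t = MulOpposite.unop ∘ τ`), as
  produced by `CartanDecompositionGLn.glTranspose`; the hypotheses `t(K) ⊆ K`, `t ∘ t = id`
  and `t g ∈ KgK` are stated elementwise.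
* Orbits `MulAction.orbit K (g : G ⧸ K)` (`= KgK/K`) and `Quotient.out` representatives are
  used throughout, matching the definition of `heckeOperator`; finiteness of the two orbits is a
  hypothesis (no `IsHeckeTriple` instance is required), counts are `Set.ncard`.
* Everything is over an arbitrary commutative coefficient ring `k` and any `Representation`;
  no topology, measure or field structure on `G` is used, and the only import is
  `HeckeAlgebra` (every statement carries the finiteness of the relevant double cosets as a
  hypothesis, so no junk-value lemma for infinite orbits is needed).

## References

* D. Bump, *Automorphic Forms and Representations* (1997), Thm. 4.6.1, §4.6, proof of
  Thm. 3.3.3 [Bump1997].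
* J. R. Getz, H. Hahn, *An Introduction to Automorphic Representations* (2024), Thm. 5.5.1
  [GetzHahn2024].
* A. Deitmar, S. Echterhoff, *Principles of Harmonic Analysis* (2014), Thm. 11.2.4
  [DeitmarEchterhoff2014].
-/

noncomputable section

open scoped Pointwise
open MulAction

namespace Literature.NumberTheory.Automorphic

section GelfandTrick

variable {k G V : Type*} [CommRing k] [Group G] [AddCommGroup V] [Module k V]
  (ρ : Representation k G V) (K : Subgroup G)

/-! #### Orbits in `G ⧸ K` and representatives -/

omit [CommRing k] in
/-- `κ • (g K) = (κ g) K` for `κ ∈ K` acting on `G ⧸ K`. [folklore] -/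
theorem subgroup_smul_mk (κ : K) (g : G) : κ • (g : G ⧸ K) = ((κ : G) * g : G) := rfl

/-- Membership in the `K`-orbit of `g K`: `γ = (κ g) K` for some `κ ∈ K`. [folklore] -/
theorem mem_orbit_mk_iff {g : G} {γ : G ⧸ K} :
    γ ∈ orbit K (g : G ⧸ K) ↔ ∃ κ : K, (((κ : G) * g : G) : G ⧸ K) = γ := by
  simp only [MulAction.mem_orbit_iff, subgroup_smul_mk]

/-- The `K`-orbit of `g K` only depends on the double coset: `(k₁ g k₂) K` has the same orbit as
`g K` for `k₁, k₂ ∈ K`. [folklore] -/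
theorem orbit_mk_mul_mul_eq {g k₁ k₂ : G} (hk₁ : k₁ ∈ K) (hk₂ : k₂ ∈ K) :
    orbit K ((k₁ * g * k₂ : G) : G ⧸ K) = orbit K (g : G ⧸ K) := by
  have h : ((k₁ * g * k₂ : G) : G ⧸ K) = (⟨k₁, hk₁⟩ : K) • (g : G ⧸ K) := by
    rw [subgroup_smul_mk, QuotientGroup.eq]
    simpa [mul_assoc] using K.inv_mem hk₂
  rw [h, MulAction.orbit_smul]

/-- For a `K`-fixed vector `v`, `ρ g v` only depends on the coset `g K`. [folklore] -/
theorem apply_eq_of_mk_eq {v : V} (hv : v ∈ ρ.fixedPoints K) {g g' : G}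
    (h : (g : G ⧸ K) = (g' : G ⧸ K)) : ρ g v = ρ g' v := by
  rw [QuotientGroup.eq] at h
  have : g' = g * (g⁻¹ * g') := by group
  rw [this, map_mul, Module.End.mul_apply, (ρ.mem_fixedPoints K v).1 hv _ h]

/-- For a `K`-fixed vector `v` and `γ ∈ G ⧸ K`, `ρ (a γ.out) v = ρ (a • γ).out v`. [folklore] -/
theorem apply_mul_out_eq {v : V} (hv : v ∈ ρ.fixedPoints K) (a : G) (γ : G ⧸ K) :
    ρ (a * γ.out) v = ρ (a • γ).out v := by
  refine apply_eq_of_mk_eq ρ K hv ?_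
  rw [QuotientGroup.out_eq', ← MulAction.Quotient.coe_smul_out, smul_eq_mul]

/-- The Hecke operator as a finite sum over the orbit, with `Quotient.out` representatives:
`[KgK] v = ∑_{α ∈ K·gK} ρ(α.out) v` for `v ∈ V^K` and `K g K / K` finite. [folklore] -/
theorem heckeOperator_apply_eq_sum_out (g : G) (hfin : (orbit K (g : G ⧸ K)).Finite) {v : V}
    (hv : v ∈ ρ.fixedPoints K) :
    heckeOperator ρ K g v = ∑ α ∈ hfin.toFinset, ρ α.out v := by
  classical
  have hs : Set.BijOn (fun x : G => (x : G ⧸ K)) (hfin.toFinset.image Quotient.out)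
      (orbit K (g : G ⧸ K)) := by
    refine ⟨?_, ?_, ?_⟩
    · intro x hx
      obtain ⟨y, hy, rfl⟩ := Finset.mem_image.1 hx
      rw [Set.Finite.mem_toFinset] at hy
      simpa only [QuotientGroup.out_eq'] using hy
    · intro x hx x' hx' h
      obtain ⟨y, -, rfl⟩ := Finset.mem_image.1 hx
      obtain ⟨y', -, rfl⟩ := Finset.mem_image.1 hx'
      simp only [QuotientGroup.out_eq'] at h
      rw [h]
    · intro y hy
      exact ⟨y.out, Finset.mem_image.2 ⟨y, (Set.Finite.mem_toFinset _).2 hy, rfl⟩,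
        QuotientGroup.out_eq' y⟩
  have hinj : ∀ x ∈ hfin.toFinset, ∀ y ∈ hfin.toFinset, x.out = y.out → x = y :=
    fun x _ y _ h => by rw [← QuotientGroup.out_eq' x, ← QuotientGroup.out_eq' y, h]
  rw [heckeOperator_apply_eq_sum ρ K g _ hs hv, Finset.sum_image hinj]

/-- The Hecke operator `[KgK]` only depends on the double coset (through the orbit `K·gK`).
[folklore] -/
theorem heckeOperator_eq_of_orbit_eq {x x' : G}
    (h : orbit K (x : G ⧸ K) = orbit K (x' : G ⧸ K)) :
    heckeOperator ρ K x = heckeOperator ρ K x' := by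
  simp only [heckeOperator, h]

/-- `[K (k₁ g k₂) K] = [K g K]` for `k₁, k₂ ∈ K`. [folklore] -/
theorem heckeOperator_mul_mul_eq {g k₁ k₂ : G} (hk₁ : k₁ ∈ K) (hk₂ : k₂ ∈ K) :
    heckeOperator ρ K (k₁ * g * k₂) = heckeOperator ρ K g :=
  heckeOperator_eq_of_orbit_eq ρ K (orbit_mk_mul_mul_eq K hk₁ hk₂)

/-- An element `c` commuting with `K` maps `V^K` to `V^K`. [folklore] -/
theorem apply_mem_fixedPoints_of_commute {c : G} (hcK : ∀ κ ∈ K, c * κ = κ * c) {v : V}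
    (hv : v ∈ ρ.fixedPoints K) : ρ c v ∈ ρ.fixedPoints K := by
  rw [Representation.mem_fixedPoints] at hv ⊢
  intro κ hκ
  rw [← Module.End.mul_apply, ← map_mul, ← hcK κ hκ, map_mul, Module.End.mul_apply, hv κ hκ]

/-- **Hecke operators commute with the centraliser.** If `c` commutes with every element of `K`
and with `x`, and `KxK/K` is finite, then `[KxK] (ρ(c) v) = ρ(c) ([KxK] v)` on `V^K` (e.g. `c`
in another factor of a restricted product; Bump (1997), §3.3). [folklore] -/
theorem heckeOperator_apply_comm_of_commute {c x : G} (hcK : ∀ κ ∈ K, c * κ = κ * c)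
    (hcx : c * x = x * c) (hfin : (orbit K (x : G ⧸ K)).Finite) {v : V}
    (hv : v ∈ ρ.fixedPoints K) :
    heckeOperator ρ K x (ρ c v) = ρ c (heckeOperator ρ K x v) := by
  have hcv := apply_mem_fixedPoints_of_commute ρ K hcK hv
  rw [heckeOperator_apply_eq_sum_out ρ K x hfin hcv, heckeOperator_apply_eq_sum_out ρ K x hfin hv,
    map_sum]
  refine Finset.sum_congr rfl fun α hα => ?_
  rw [Set.Finite.mem_toFinset] at hα
  obtain ⟨κ, hκ⟩ := (mem_orbit_mk_iff K).1 hα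
  obtain ⟨κ', hκ'⟩ := QuotientGroup.mk_out_eq_mul K ((κ : G) * x)
  rw [hκ] at hκ'
  have hc : α.out * c = c * α.out := by
    rw [hκ']
    calc (κ : G) * x * κ' * c = κ * x * (κ' * c) := by group
      _ = κ * x * (c * κ') := by rw [hcK _ κ'.2]
      _ = κ * (x * c) * κ' := by group
      _ = κ * (c * x) * κ' := by rw [hcx]
      _ = (κ * c) * x * κ' := by group
      _ = (c * κ) * x * κ' := by rw [hcK _ κ.2]
      _ = c * (κ * x * κ') := by group
  rw [← Module.End.mul_apply, ← map_mul, hc, map_mul, Module.End.mul_apply]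

/-- **Averaging formula.** If an additive map `P` out of `V` is invariant under `K`
(`P (ρ κ w) = P w`), then `P ([KxK] v) = #(KxK/K) • P (ρ x v)` for `v ∈ V^K`: each term
`ρ(κ x κ') v = ρ(κ) ρ(x) v` of the Hecke sum has the same image under `P`. (With `P` the
orthogonal projection onto `V^K` of a unitary representation this is
`P(π(x) v) = [KxK] v / deg`, Deitmar–Echterhoff (2014), proof of Thm. 11.2.4 (b).) [folklore] -/
theorem map_heckeOperator_eq_card_smul {W : Type*} [AddCommMonoid W] (P : V →+ W)
    (hP : ∀ κ ∈ K, ∀ w : V, P (ρ κ w) = P w) (x : G) (hfin : (orbit K (x : G ⧸ K)).Finite)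
    {v : V} (hv : v ∈ ρ.fixedPoints K) :
    P (heckeOperator ρ K x v) = hfin.toFinset.card • P (ρ x v) := by
  rw [heckeOperator_apply_eq_sum_out ρ K x hfin hv, map_sum, ← Finset.sum_const]
  refine Finset.sum_congr rfl fun α hα => ?_
  rw [Set.Finite.mem_toFinset] at hα
  obtain ⟨κ, hκ⟩ := (mem_orbit_mk_iff K).1 hα
  have : ρ α.out v = ρ ((κ : G) * x) v :=
    apply_eq_of_mk_eq ρ K hv (by rw [QuotientGroup.out_eq', hκ])
  rw [this, map_mul, Module.End.mul_apply, hP _ κ.2]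

/-! #### The pair count `N_{x,y}` and the product formula -/

/-- The **pair count** of Gelfand's trick: for `x, y ∈ G` and `γ ∈ G ⧸ K`,
`N_{x,y}(γ) = #{α ∈ K x K / K | α⁻¹ γ ∈ K y K / K}` — the number of ways of writing `γ = α β`
with `α ∈ KxK/K`, `β ∈ KyK/K`; these are the structure constants
`𝟙_{KxK} * 𝟙_{KyK} = ∑_γ N_{x,y}(γ) 𝟙_{γ}` of the Hecke algebra (Bump (1997), §4.6;
Shimura (1971), §3.1). [folklore] -/
def heckePairCount (x y : G) (γ : G ⧸ K) : ℕ :=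
  {α ∈ orbit K (x : G ⧸ K) | α.out⁻¹ • γ ∈ orbit K (y : G ⧸ K)}.ncard

/-- The condition `α.out⁻¹ • γ ∈ K y K / K` does not depend on the representative of `α`.
[folklore] -/
theorem inv_smul_mem_orbit_iff_of_mk_eq {y a : G} {α γ : G ⧸ K} (ha : (a : G ⧸ K) = α) :
    α.out⁻¹ • γ ∈ orbit K (y : G ⧸ K) ↔ a⁻¹ • γ ∈ orbit K (y : G ⧸ K) := by
  obtain ⟨κ, hκ⟩ : ∃ κ : K, α.out = a * κ := by
    rw [← ha]
    exact QuotientGroup.mk_out_eq_mul K a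
  rw [hκ, mul_inv_rev, mul_smul]
  constructor
  · intro h
    have := MulAction.mem_orbit_of_mem_orbit κ h
    change (κ : G) • ((κ : G)⁻¹ • (a⁻¹ • γ)) ∈ _ at this
    rwa [smul_inv_smul] at this
  · intro h
    have := MulAction.mem_orbit_of_mem_orbit κ⁻¹ h
    exact this

/-- **Product formula.** For `v ∈ V^K` and finite double cosets `KxK/K`, `KyK/K`:
`[KxK] ([KyK] v) = ∑ᶠ γ ∈ G ⧸ K, N_{x,y}(γ) • ρ(γ.out) v` (Bump (1997), §4.6; Shimura (1971),
§3.1: the action of the product `𝟙_{KxK} * 𝟙_{KyK}`). [folklore] -/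
theorem heckeOperator_heckeOperator_apply (x y : G) (hx : (orbit K (x : G ⧸ K)).Finite)
    (hy : (orbit K (y : G ⧸ K)).Finite) {v : V} (hv : v ∈ ρ.fixedPoints K) :
    heckeOperator ρ K x (heckeOperator ρ K y v) =
      ∑ᶠ γ : G ⧸ K, (heckePairCount K x y γ : k) • ρ γ.out v := by
  classical
  have hyv : heckeOperator ρ K y v ∈ ρ.fixedPoints K :=
    heckeOperator_apply_mem_fixedPoints ρ K y hv hy
  rw [heckeOperator_apply_eq_sum_out ρ K x hx hyv]
  simp_rw [heckeOperator_apply_eq_sum_out ρ K y hy hv, map_sum]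
  -- regroup the inner sums along `β ↦ α.out • β`
  have hinner : ∀ α : G ⧸ K, ∑ β ∈ hy.toFinset, ρ α.out (ρ β.out v) =
      ∑ γ ∈ hy.toFinset.image (α.out • ·), ρ γ.out v := by
    intro α
    rw [Finset.sum_image (fun β _ β' _ h => smul_left_cancel α.out h)]
    refine Finset.sum_congr rfl fun β _ => ?_
    rw [← Module.End.mul_apply, ← map_mul, apply_mul_out_eq ρ K hv]
  simp_rw [hinner]
  -- the support of the right-hand side
  set U : Finset (G ⧸ K) := hx.toFinset.biUnion fun α => hy.toFinset.image (α.out • ·) with hU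
  have hmemU : ∀ {α γ : G ⧸ K}, α ∈ hx.toFinset → (γ ∈ hy.toFinset.image (α.out • ·) ↔
      α.out⁻¹ • γ ∈ orbit K (y : G ⧸ K)) := by
    intro α γ _
    rw [Finset.mem_image]
    constructor
    · rintro ⟨β, hβ, rfl⟩
      rw [inv_smul_smul]
      exact (Set.Finite.mem_toFinset _).1 hβ
    · intro h
      exact ⟨α.out⁻¹ • γ, (Set.Finite.mem_toFinset _).2 h, smul_inv_smul _ _⟩
  have hcount : ∀ γ : G ⧸ K, heckePairCount K x y γ =
      (hx.toFinset.filter fun α => γ ∈ hy.toFinset.image (α.out • ·)).card := by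
    intro γ
    rw [heckePairCount, ← Set.ncard_coe_finset]
    congr 1
    ext α
    simp only [Set.mem_setOf_eq, Finset.coe_filter, Set.Finite.mem_toFinset]
    constructor
    · rintro ⟨hα, h⟩
      exact ⟨hα, (hmemU ((Set.Finite.mem_toFinset _).2 hα)).2 h⟩
    · rintro ⟨hα, h⟩
      exact ⟨hα, (hmemU ((Set.Finite.mem_toFinset _).2 hα)).1 h⟩
  have hsupp : ∀ γ : G ⧸ K, γ ∉ U → heckePairCount K x y γ = 0 := by
    intro γ hγ
    rw [hcount, Finset.card_eq_zero, Finset.filter_eq_empty_iff]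
    intro α hα h
    exact hγ (Finset.mem_biUnion.2 ⟨α, hα, h⟩)
  rw [finsum_eq_sum_of_support_subset _ (s := U)]
  · -- both sides are sums over `U`; swap the order of summation
    have : ∀ α ∈ hx.toFinset, ∑ γ ∈ hy.toFinset.image (α.out • ·), ρ γ.out v =
        ∑ γ ∈ U, if γ ∈ hy.toFinset.image (α.out • ·) then ρ γ.out v else 0 := by
      intro α hα
      rw [← Finset.sum_filter, Finset.filter_mem_eq_inter, Finset.inter_eq_right.2]
      exact Finset.subset_biUnion_of_mem (fun α => hy.toFinset.image (α.out • ·)) hα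
    rw [Finset.sum_congr rfl this, Finset.sum_comm]
    refine Finset.sum_congr rfl fun γ _ => ?_
    rw [Finset.sum_ite, Finset.sum_const_zero, add_zero, Finset.sum_const, hcount,
      Nat.cast_smul_eq_nsmul]
  · intro γ hγ
    by_contra h
    apply hγ
    change ((heckePairCount K x y γ : ℕ) : k) • ρ γ.out v = 0
    rw [hsupp γ (by simpa using h), Nat.cast_zero, zero_smul]


/-! #### Invariance and vanishing of the pair count -/

/-- Left `K`-invariance of the pair count: `N_{x,y}(κ γ) = N_{x,y}(γ)` (reindex `α ↦ κ α`).
[folklore] -/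
theorem heckePairCount_smul (x y : G) (κ : K) (γ : G ⧸ K) :
    heckePairCount K x y (κ • γ) = heckePairCount K x y γ := by
  unfold heckePairCount
  have key : ∀ α : G ⧸ K, (κ • α).out⁻¹ • κ • γ ∈ orbit K (y : G ⧸ K) ↔
      α.out⁻¹ • γ ∈ orbit K (y : G ⧸ K) := by
    intro α
    have hrep : (((κ : G) * α.out : G) : G ⧸ K) = κ • α := by
      conv_rhs => rw [← QuotientGroup.out_eq' α]
      rfl
    rw [inv_smul_mem_orbit_iff_of_mk_eq K hrep, mul_inv_rev, mul_smul]
    change α.out⁻¹ • (κ : G)⁻¹ • (κ : G) • γ ∈ _ ↔ _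
    rw [inv_smul_smul]
  have hset : {α ∈ orbit K (x : G ⧸ K) | α.out⁻¹ • κ • γ ∈ orbit K (y : G ⧸ K)} =
      (fun α => κ • α) '' {α ∈ orbit K (x : G ⧸ K) | α.out⁻¹ • γ ∈ orbit K (y : G ⧸ K)} := by
    ext α
    simp only [Set.mem_setOf_eq, Set.mem_image]
    constructor
    · rintro ⟨hα, h⟩
      refine ⟨κ⁻¹ • α, ⟨MulAction.mem_orbit_of_mem_orbit κ⁻¹ hα, ?_⟩, smul_inv_smul κ α⟩
      rw [← key, smul_inv_smul]
      exact h
    · rintro ⟨β, ⟨hβ, h⟩, rfl⟩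
      exact ⟨MulAction.mem_orbit_of_mem_orbit κ hβ, (key β).2 h⟩
  rw [hset, Set.ncard_image_of_injective _ (MulAction.injective κ)]

/-- An element of the orbit `K x K / K` has its `out`-representative in `K x K`, hence in any
subgroup `M ⊇ K ∋ x`. [folklore] -/
theorem out_mem_of_mem_orbit {M : Subgroup G} (hKM : K ≤ M) {x : G} (hx : x ∈ M) {α : G ⧸ K}
    (hα : α ∈ orbit K (x : G ⧸ K)) : α.out ∈ M := by
  obtain ⟨κ, hκ⟩ := (mem_orbit_mk_iff K).1 hα
  obtain ⟨κ', hκ'⟩ := QuotientGroup.mk_out_eq_mul K ((κ : G) * x)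
  rw [← hκ, hκ']
  exact M.mul_mem (M.mul_mem (hKM κ.2) hx) (hKM κ'.2)

/-- The pair count `N_{x,y}(γ)` vanishes unless `γ` has a representative in the subgroup
generated by `K`, `x`, `y` (indeed `γ = α β` with `α ∈ KxK`, `β ∈ KyK`). [folklore] -/
theorem heckePairCount_eq_zero_of_out_not_mem {M : Subgroup G} (hKM : K ≤ M) {x y : G}
    (hx : x ∈ M) (hy : y ∈ M) {γ : G ⧸ K} (hγ : γ.out ∉ M) : heckePairCount K x y γ = 0 := by
  unfold heckePairCount
  convert Set.ncard_empty (G ⧸ K)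
  ext α
  simp only [Set.mem_setOf_eq, Set.mem_empty_iff_false, iff_false, not_and]
  intro hα h
  apply hγ
  have ha : α.out ∈ M := out_mem_of_mem_orbit K hKM hx hα
  have hb : (α.out⁻¹ • γ).out ∈ M := out_mem_of_mem_orbit K hKM hy h
  have hrep : (((α.out⁻¹ * γ.out : G)) : G ⧸ K) = α.out⁻¹ • γ := by
    rw [← smul_eq_mul, MulAction.Quotient.coe_smul_out]
  obtain ⟨κ, hκ⟩ := QuotientGroup.mk_out_eq_mul K (α.out⁻¹ * γ.out)
  rw [hrep] at hκ
  have : γ.out = α.out * ((α.out⁻¹ • γ).out * (κ : G)⁻¹) := by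
    rw [hκ]
    group
  rw [this]
  exact M.mul_mem ha (M.mul_mem hb (M.inv_mem (hKM κ.2)))

/-! #### Gelfand's trick: symmetry of the pair count under an anti-involution -/

variable (τ : G ≃* Gᵐᵒᵖ)

/-- If `τ` is an anti-automorphism preserving `K` and `τ x ∈ K x K`, then `τ` maps `K x K` into
`K x K`; on cosets: `(τ a) K ∈ K·xK` for `a K ∈ K·xK`. [folklore] -/
theorem mk_unop_map_mem_orbit (hτK : ∀ κ ∈ K, (τ κ).unop ∈ K) {x : G}
    (hx : ∃ k₁ ∈ K, ∃ k₂ ∈ K, (τ x).unop = k₁ * x * k₂) {a : G}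
    (ha : (a : G ⧸ K) ∈ orbit K (x : G ⧸ K)) :
    (((τ a).unop : G) : G ⧸ K) ∈ orbit K (x : G ⧸ K) := by
  obtain ⟨k₁, hk₁, k₂, hk₂, hxe⟩ := hx
  obtain ⟨κ, hκ⟩ := (mem_orbit_mk_iff K).1 ha
  rw [QuotientGroup.eq] at hκ
  -- `a = κ x κ'` with `κ' = (κ x)⁻¹ a ∈ K`
  have ha' : a = (κ : G) * x * (((κ : G) * x)⁻¹ * a) := by group
  have hτa : (τ a).unop = (τ (((κ : G) * x)⁻¹ * a)).unop * (k₁ * x * k₂) * (τ (κ : G)).unop := by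
    conv_lhs => rw [ha']
    rw [map_mul, map_mul, MulOpposite.unop_mul, MulOpposite.unop_mul, hxe]
    simp only [mul_assoc]
  rw [hτa, mem_orbit_mk_iff]
  refine ⟨⟨(τ (((κ : G) * x)⁻¹ * a)).unop * k₁, K.mul_mem (hτK _ hκ) hk₁⟩, ?_⟩
  rw [QuotientGroup.eq]
  simpa [mul_assoc] using K.mul_mem hk₂ (hτK _ κ.2)

/-- **Gelfand's injection.** With `t = unop ∘ τ` an anti-involution of `G` preserving `K` and
fixing the double cosets of `x` and `y`, the map `a K ↦ t(a⁻¹ c) K` injects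
`{a K ⊆ KxK | a⁻¹ c ∈ KyK}` into `{b K ⊆ KyK | b⁻¹ t(c) ∈ KxK}`, whence
`N_{x,y}(c K) ≤ N_{y,x}(t(c) K)` (Bump (1997), proof of Thm. 4.6.1; Deitmar–Echterhoff
(2014), proof of Thm. 11.2.4 (a)). [folklore] -/
theorem heckePairCount_le_unop_map (hτK : ∀ κ ∈ K, (τ κ).unop ∈ K)
    (hτ2 : ∀ g : G, (τ (τ g).unop).unop = g) {x y : G}
    (hx : ∃ k₁ ∈ K, ∃ k₂ ∈ K, (τ x).unop = k₁ * x * k₂)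
    (hy : ∃ k₁ ∈ K, ∃ k₂ ∈ K, (τ y).unop = k₁ * y * k₂)
    (hyfin : (orbit K (y : G ⧸ K)).Finite) (c : G) :
    heckePairCount K x y (c : G ⧸ K) ≤ heckePairCount K y x ((τ c).unop : G ⧸ K) := by
  unfold heckePairCount
  -- algebra of the anti-automorphism
  have hinv : ∀ u : G, ((τ u).unop)⁻¹ = (τ u⁻¹).unop := fun u => by
    rw [map_inv, MulOpposite.unop_inv]
  have hmul : ∀ u w : G, (τ u).unop * (τ w).unop = (τ (w * u)).unop := fun u w => by
    rw [map_mul, MulOpposite.unop_mul]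
  refine Set.ncard_le_ncard_of_injOn (fun α => (((τ (α.out⁻¹ * c)).unop : G) : G ⧸ K))
    ?_ ?_ (hyfin.subset (Set.sep_subset _ _))
  · -- maps into the target set
    rintro α ⟨hα, h⟩
    have h' : (((α.out⁻¹ * c : G)) : G ⧸ K) ∈ orbit K (y : G ⧸ K) := by
      rwa [MulAction.Quotient.smul_coe, smul_eq_mul] at h
    refine ⟨mk_unop_map_mem_orbit K τ hτK hy h', ?_⟩
    rw [inv_smul_mem_orbit_iff_of_mk_eq K rfl, MulAction.Quotient.smul_coe, smul_eq_mul,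
      hinv, hmul, mul_inv_rev, inv_inv, mul_inv_cancel_left]
    have hαx : ((α.out : G) : G ⧸ K) ∈ orbit K (x : G ⧸ K) := by rwa [QuotientGroup.out_eq']
    exact mk_unop_map_mem_orbit K τ hτK hx hαx
  · -- injective
    rintro α₁ ⟨-, -⟩ α₂ ⟨-, -⟩ h
    change (((τ (α₁.out⁻¹ * c)).unop : G) : G ⧸ K) = (((τ (α₂.out⁻¹ * c)).unop : G) : G ⧸ K) at h
    rw [QuotientGroup.eq, hinv, hmul, mul_inv_rev, inv_inv, mul_assoc, mul_inv_cancel_left] at h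
    have h2 : α₂.out⁻¹ * α₁.out ∈ K := by
      have := hτK _ h
      rwa [hτ2] at this
    rw [← QuotientGroup.eq] at h2
    rw [← QuotientGroup.out_eq' α₁, ← QuotientGroup.out_eq' α₂, h2]

/-- **Symmetry of the pair count** (Gelfand's trick): under an anti-involution `t` of `G`
preserving `K` with `t g ∈ K g K` for `g = x, y, c`, one has `N_{x,y}(c K) = N_{y,x}(c K)`:
`N_{x,y}(c) ≤ N_{y,x}(t c) ≤ N_{x,y}(t t c) = N_{x,y}(c)` and `N_{y,x}(t c) = N_{y,x}(c)` by
left `K`-invariance (Bump (1997), Thm. 4.6.1; Deitmar–Echterhoff (2014), Thm. 11.2.4 (a)).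
[folklore] -/
theorem heckePairCount_comm (hτK : ∀ κ ∈ K, (τ κ).unop ∈ K)
    (hτ2 : ∀ g : G, (τ (τ g).unop).unop = g) {x y : G}
    (hx : ∃ k₁ ∈ K, ∃ k₂ ∈ K, (τ x).unop = k₁ * x * k₂)
    (hy : ∃ k₁ ∈ K, ∃ k₂ ∈ K, (τ y).unop = k₁ * y * k₂)
    (hxfin : (orbit K (x : G ⧸ K)).Finite) (hyfin : (orbit K (y : G ⧸ K)).Finite) {c : G}
    (hc : ∃ k₁ ∈ K, ∃ k₂ ∈ K, (τ c).unop = k₁ * c * k₂) :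
    heckePairCount K x y (c : G ⧸ K) = heckePairCount K y x (c : G ⧸ K) := by
  have h₁ := heckePairCount_le_unop_map K τ hτK hτ2 hx hy hyfin c
  have h₂ := heckePairCount_le_unop_map K τ hτK hτ2 hy hx hxfin (τ c).unop
  rw [hτ2] at h₂
  have heq : heckePairCount K x y (c : G ⧸ K) = heckePairCount K y x ((τ c).unop : G ⧸ K) :=
    le_antisymm h₁ h₂
  obtain ⟨k₁, hk₁, k₂, hk₂, hce⟩ := hc
  have hcoset : (((τ c).unop : G) : G ⧸ K) = (⟨k₁, hk₁⟩ : K) • (c : G ⧸ K) := by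
    rw [hce, subgroup_smul_mk, QuotientGroup.eq]
    simpa [mul_assoc] using K.inv_mem hk₂
  rw [heq, hcoset, heckePairCount_smul]

/-- **Gelfand's trick: Hecke operators commute.** Let `K ≤ M ≤ G` be subgroups and
`t = unop ∘ τ` an anti-involution of `G` (`τ : G ≃* Gᵐᵒᵖ`, `t ∘ t = id`) with `t(K) ⊆ K` and
`t g ∈ K g K` for every `g ∈ M`. Then for `x, y ∈ M` with finite double cosets `KxK/K`, `KyK/K`,
the Hecke operators `[KxK]` and `[KyK]` commute on `V^K`, for every representation of `G`:
`[KxK][KyK] v = ∑_γ N_{x,y}(γ) ρ(γ) v` with `N_{x,y} = N_{y,x}` on cosets meeting `M` and both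
zero elsewhere. For `G ⊇ M = GL_n(F)`, `K = GL_n(𝒪)`, `t` = transpose and the Cartan
decomposition this is the commutativity of the spherical Hecke algebra (Bump (1997),
Thm. 4.6.1 and proof of Thm. 3.3.3; Getz–Hahn (2024), Thm. 5.5.1; Deitmar–Echterhoff (2014),
Thm. 11.2.4 (a)). [cite: Bump1997, Thm. 4.6.1] -/
theorem heckeOperator_comm_apply_of_antiInvolution (hτK : ∀ κ ∈ K, (τ κ).unop ∈ K)
    (hτ2 : ∀ g : G, (τ (τ g).unop).unop = g) {M : Subgroup G} (hKM : K ≤ M)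
    (hcoset : ∀ g ∈ M, ∃ k₁ ∈ K, ∃ k₂ ∈ K, (τ g).unop = k₁ * g * k₂) {x y : G} (hx : x ∈ M)
    (hy : y ∈ M) (hxfin : (orbit K (x : G ⧸ K)).Finite) (hyfin : (orbit K (y : G ⧸ K)).Finite)
    {v : V} (hv : v ∈ ρ.fixedPoints K) :
    heckeOperator ρ K x (heckeOperator ρ K y v) = heckeOperator ρ K y (heckeOperator ρ K x v) := by
  rw [heckeOperator_heckeOperator_apply ρ K x y hxfin hyfin hv,
    heckeOperator_heckeOperator_apply ρ K y x hyfin hxfin hv]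
  refine finsum_congr fun γ => ?_
  congr 2
  by_cases hγ : γ.out ∈ M
  · have := heckePairCount_comm K τ hτK hτ2 (hcoset x hx) (hcoset y hy) hxfin hyfin (hcoset _ hγ)
    rwa [QuotientGroup.out_eq'] at this
  · rw [heckePairCount_eq_zero_of_out_not_mem K hKM hx hy hγ,
      heckePairCount_eq_zero_of_out_not_mem K hKM hy hx hγ]

/-! #### Degrees: `#(K x⁻¹ K / K) = #(K x K / K)` under an anti-involution -/

/-- Under an anti-involution `t` preserving `K` with `t x ∈ K x K`, the map
`b K ↦ (t b)⁻¹ K` injects `K x⁻¹ K / K` into `K x K / K`; hence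
`#(K x⁻¹ K/K) ≤ #(K x K/K)`. [folklore] -/
theorem ncard_orbit_inv_le (hτK : ∀ κ ∈ K, (τ κ).unop ∈ K)
    (hτ2 : ∀ g : G, (τ (τ g).unop).unop = g) {x : G}
    (hx : ∃ k₁ ∈ K, ∃ k₂ ∈ K, (τ x).unop = k₁ * x * k₂) (hxfin : (orbit K (x : G ⧸ K)).Finite) :
    (orbit K ((x⁻¹ : G) : G ⧸ K)).ncard ≤ (orbit K (x : G ⧸ K)).ncard := by
  obtain ⟨k₁, hk₁, k₂, hk₂, hxe⟩ := hx
  have hinv : ∀ u : G, ((τ u).unop)⁻¹ = (τ u⁻¹).unop := fun u => by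
    rw [map_inv, MulOpposite.unop_inv]
  have hmul : ∀ u w : G, (τ u).unop * (τ w).unop = (τ (w * u)).unop := fun u w => by
    rw [map_mul, MulOpposite.unop_mul]
  refine Set.ncard_le_ncard_of_injOn (fun β => ((((τ β.out).unop)⁻¹ : G) : G ⧸ K)) ?_ ?_ hxfin
  · intro β hβ
    obtain ⟨κ, hκ⟩ := (mem_orbit_mk_iff K).1 hβ
    obtain ⟨κ', hκ'⟩ := QuotientGroup.mk_out_eq_mul K ((κ : G) * x⁻¹)
    rw [hκ] at hκ'
    rw [hκ', map_mul, map_mul, MulOpposite.unop_mul, MulOpposite.unop_mul, mul_inv_rev,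
      mul_inv_rev, hinv x⁻¹, inv_inv, hxe, mem_orbit_mk_iff]
    refine ⟨⟨((τ (κ : G)).unop)⁻¹ * k₁, K.mul_mem (K.inv_mem (hτK _ κ.2)) hk₁⟩, ?_⟩
    rw [QuotientGroup.eq]
    simpa [mul_assoc] using K.mul_mem hk₂ (K.inv_mem (hτK _ κ'.2))
  · intro β₁ _ β₂ _ h
    change ((((τ β₁.out).unop)⁻¹ : G) : G ⧸ K) = ((((τ β₂.out).unop)⁻¹ : G) : G ⧸ K) at h
    rw [QuotientGroup.eq, inv_inv, hinv, hmul] at h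
    have h2 : β₂.out⁻¹ * β₁.out ∈ K := by
      have := hτK _ h
      rwa [hτ2] at this
    rw [← QuotientGroup.eq] at h2
    rw [← QuotientGroup.out_eq' β₁, ← QuotientGroup.out_eq' β₂, h2]

/-- **Equality of degrees** `#(K x⁻¹ K/K) = #(K x K/K)` when `t x ∈ KxK`, `t x⁻¹ ∈ Kx⁻¹K` and
both orbits are finite (for `(GL_n(F), GL_n(𝒪))` this is the unimodularity relation
`[K : K ∩ xKx⁻¹] = [K : K ∩ x⁻¹Kx]`, used for the adjoint `[KxK]* = [Kx⁻¹K]` on unitary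
representations; Deitmar–Echterhoff (2014), §11.2). [folklore] -/
theorem ncard_orbit_inv_eq (hτK : ∀ κ ∈ K, (τ κ).unop ∈ K)
    (hτ2 : ∀ g : G, (τ (τ g).unop).unop = g) {x : G}
    (hx : ∃ k₁ ∈ K, ∃ k₂ ∈ K, (τ x).unop = k₁ * x * k₂)
    (hx' : ∃ k₁ ∈ K, ∃ k₂ ∈ K, (τ x⁻¹).unop = k₁ * x⁻¹ * k₂)
    (hxfin : (orbit K (x : G ⧸ K)).Finite) (hxfin' : (orbit K ((x⁻¹ : G) : G ⧸ K)).Finite) :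
    (orbit K ((x⁻¹ : G) : G ⧸ K)).ncard = (orbit K (x : G ⧸ K)).ncard := by
  refine le_antisymm (ncard_orbit_inv_le K τ hτK hτ2 hx hxfin) ?_
  have := ncard_orbit_inv_le K τ hτK hτ2 hx' hxfin'
  rwa [inv_inv] at this

end GelfandTrick

end Literature.NumberTheory.Automorphic
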